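import Literature.IUT.HodgeArakelov.ThetaGauChainDecision
import Literature.IUT.LogThetaLattice.StripFrameOfKitsToy
import Literature.IUT.LogThetaLattice.LogThetaLatticeCoricityProofs
import Mathlib.Algebra.GroupWithZero.Units.Fintype
import HarnessLib

/-!
# [IUTchII] Cor 4.10 (vi) — the NV-L6 row «ThetaGauChain» AT THE FRAME-INDUCED SETTING and AT THE FRAME ASSEMBLED FROM THE KITS
# (`ThetaLinkSetting.ofStripFrame`, `StripFrame.ofKits`): the inhabitation condition DECIDED, kit by kit

Mochizuki, *Inter-universal Teichmüller Theory II*, kurims manuscript (Dec 2020), §4, Cor 4.10 (i)–(iv) pp. 158–160, (vi) p. 161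
("a collection of distinct `Θ^{±ell}NF`-Hodge theaters indexed by the integers"); *I* (May 2020) Def 5.2 (iv) pp. 134–135
(`ℱ^⊩`-prime-strips "isomorphic to the collection of data `ℱ^⊩_mod` of Example 3.5, (ii)", "a morphism of `ℱ^⊩`-prime-strips is
defined to be an isomorphism between collections of data"); *III* (May 2020) Def 1.1 p. 23 (the prime-strip frame). PROOF-ONLY
companion (no `def`, no `instance`, no `structure`), part 2 of the row NV-L6-UPGRADE ThetaGauChain@ofKits (abc-iut-w5-d193 gen 3;
L6-lead §F v1.19a (3) «genuine-frame UPGRADES of the degenerate witnesses»): part 1 (`ThetaGauChainDecision.lean`) decided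
abc-iut-w5-d193's criterion `ThetaGauChain.nonempty_iff_infinite` (p419396) over ANY setting; this file reads that decision on every
frame the tree has — the pattern of abc-iut-w5-d005's `FrobeniusChainCoricOfKits.lean` (p421256) for [IUTchIII] Prop 1.2 (x).

* THE FRAME-INDUCED SETTING `ThetaLinkSetting.ofStripFrame S` (abc-iut-L6-t3 `StripFrameThetaLinks`; § 2): positives from
  infinitely many `F^⊩`-prime-strips `S.Fgl` / one `F^⊩`- or `F^{⊢×μ}`-prime-strip of infinite automorphism group, negative from
  finiteness; and the CONSUMERS quantified over `P : ThetaGauChain (ofStripFrame S)` — abc-iut-L6-d1's `unitMuCoric_chain`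
  ([IUTchII] Cor 4.10 (iv) along the chain ⇐ [IUTchIII] Thm 2.2 (i)) and `thm15ii_chain_map_full` ([IUTchIII] Thm 1.5 (ii) on the
  chain) — INSTANTIATED under «infinitely many `F^⊩`-prime-strips» (`StripFrame.exists_thetaGauChain_unitMuCoric`, `…_map_full`).
* KIT LEVEL (abc-iut-L5-t4's `PMBaseKit.FKit`, [IUTchI] Def 5.2 (iv); § 3): an `ℱ^⊩`-prime-strip is determined by its collection of
  data (`FKit.FrStrip.obj_injective`); finitely many objects of the ambient category `RlfAmb` ⇒ finitely many `ℱ^⊩`-prime-strips;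
  `Infinite` iff the isomorphs of `ℱ^⊩_mod` form an infinite type (`infinite_iff_subtype`); the isomorphisms ARE the ambient ones
  (`nonempty_isoEquiv`); the MODEL `ℱ^⊩_mod` is an `ℱ^⊩`-prime-strip of every kit (`nonempty_model`).
* `StripFrame.ofKits L hbij hsurj hR X` (abc-iut-L6-t3, [IUTchIII] Def 1.1; § 4): `StripFrame.nonempty_hodgeTheaterStrips_ofKits` —
  Cor 4.10 (i)–(iv)'s strip package EXISTS over EVERY kit (the model `ℱ^⊩_mod` in all five slots: a GENUINE-frame inhabitant of the
  interface `HodgeTheaterStrips` relative to the kits, no toy choice); POSITIVE `…nonempty_thetaGauChain_ofKits_of_infinite_frStrip`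
  / `_of_infinite_isomorphs` (infinitely many isomorphs of `ℱ^⊩_mod` in `RlfAmb` — in print a proper class) / `_of_infinite_aut`
  (infinitely many automorphisms of the collection of data `ℱ^⊩_mod` — in print `Aut(ℱ^⊩_mod)` contains the automorphisms of
  `𝔉^⊢_mod` compatible with the `ρ_v`, an infinite group: the intended reading); NEGATIVE `…isEmpty_thetaGauChain_ofKits_of_finite`
  for every kit with finitely many objects and isomorphisms in `RlfAmb` and finite isomorphism types of `F^{⊢×μ}`-prime-strips.
* THE DECISION AT THE LANDED CONCRETE KIT (§ 5) — abc-iut-L5-t4's TOY kit `FKit.toy l hl` (one place `𝕍 = Unit`,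
  `RlfAmb = (𝕍 → {loc, glob})`, `ℱ^⊩_mod = (v ↦ loc)`, `Hom(loc, loc) = ℤˣ`) under abc-iut-L6-t3's toy frame `KitsToy.frame l hl`
  (`F^{⊢×μ} :=` the one-object groupoid `SingleObj Unit`): `KitsToy.frStrip_obj_eq` (every `ℱ^⊩`-prime-strip IS the model),
  `subsingleton_frStrip`, `finite_frStrip`, `finite_frStrip_iso`, `finite_fxm_iso`, hence **`KitsToy.isEmpty_thetaGauChain :
  IsEmpty (ThetaGauChain (ThetaLinkSetting.ofStripFrame (KitsToy.frame l hl)))`** — the only `StripFrame.ofKits` instance in the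
  tree carries NO chain of DISTINCT `Θ^{±ell}NF`-Hodge theaters (while `KitsToy.nonempty_hodgeTheaterStrips`: it does carry a strip
  package), exactly as abc-iut-w5-d005's `KitsToy.isEmpty_frobeniusChain` for [IUTchIII] Prop 1.2 (x). So the consumers over
  `P : ThetaGauChain (ofStripFrame S)` remain instantiated at abc-iut-w5-d193's degenerate `ℤ`-labelled setting
  (`ThetaGauChain.nonempty_degenerate`) and CONDITIONALLY (§ 2/§ 4 hypotheses) at every frame with infinitely many
  `F^⊩`-prime-strips or an `F^⊩`- or `F^{⊢×μ}`-prime-strip with infinitely many automorphisms — in print both hold, so `Infinite`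
  is the intended reading and the toy's finiteness is a DISCLOSED TRUNCATION of the toy, not a finding about the series.

HONEST LABEL (L6-lead §F v1.18p (4) / v1.19c): the § 4 inhabitant of `HodgeTheaterStrips` at `ofKits` is GENUINE relative to the
kits (every kit, the model `ℱ^⊩`-prime-strip); `ThetaGauChain` at `ofKits` is DECIDED NEGATIVELY at the toy kit and reduced in general
to the cardinalities of the ambient kind `RlfAmb`, of `Aut(ℱ^⊩_mod)` and of the `F^{⊢×μ}`-isomorphism types. Nothing of
[IUTchII]/[IUTchIII] is asserted; a witness is consistency evidence only; typed ≠ proved; no side is taken on [IUTchIII] Cor 3.12.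
[claim: Mochizuki2012, status: disputed]
-/

/-! ### 2. The frame-induced setting `ThetaLinkSetting.ofStripFrame S` ([IUTchIII] Def 1.1 frame) and the consumers -/

namespace Literature.IUT.LogThetaLattice

open CategoryTheory
open Literature.IUT.HodgeArakelov Literature.IUT.HodgeTheaters Literature.IUT.HodgeTheaters.PMBaseKit

universe u

namespace StripFrame

variable (S : StripFrame.{u})

/-- **IUTchII:Cor4.10(i)** (kurims p.158) Over a strip frame with an `F^⊩`-prime-strip, the strip package of Cor 4.10 (i)–(iv) exists
(setting induced by the frame, abc-iut-L6-t3's `ThetaLinkSetting.ofStripFrame`). [claim: Mochizuki2012, status: disputed] -/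
theorem nonempty_hodgeTheaterStrips_of_obj (X : S.Fgl) :
    Nonempty (HodgeTheaterStrips (ThetaLinkSetting.ofStripFrame S)) :=
  HodgeTheaterStrips.nonempty_of_obj _ X

/-- **IUTchII:Cor4.10(vi)** (kurims p.161) Over a strip frame with infinitely many `F^⊩`-prime-strips (objects of `S.Fgl`) there is a
chain of DISTINCT `Θ^{±ell}NF`-Hodge theaters `… ⟶ ⁿHT ⟶ ⁽ⁿ⁺¹⁾HT ⟶ …` through their strips. [claim: Mochizuki2012, status: disputed] -/
theorem nonempty_thetaGauChain_of_infinite_Fgl [Infinite S.Fgl] :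
    Nonempty (ThetaGauChain (ThetaLinkSetting.ofStripFrame S)) :=
  ThetaGauChain.nonempty_of_infinite_obj _

/-- **IUTchII:Cor4.10(vi)** (kurims p.161) … or with ONE `F^⊩`-prime-strip of infinite automorphism group. [claim: Mochizuki2012, status: disputed] -/
theorem nonempty_thetaGauChain_of_infinite_aut (X : S.Fgl) (h : Infinite (X ≅ X)) :
    Nonempty (ThetaGauChain (ThetaLinkSetting.ofStripFrame S)) :=
  ThetaGauChain.nonempty_of_infinite_aut _ X h

/-- **IUTchII:Cor4.10(vi)** (kurims p.161) … or with ONE `F^{⊢×μ}`-prime-strip `F^{⊢×μ}(F^{⊩▶×μ}(X))` of infinite automorphism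
group. [claim: Mochizuki2012, status: disputed] -/
theorem nonempty_thetaGauChain_of_infinite_unitAut (X : S.Fgl)
    (h : Infinite (S.FglxmToFxm.obj (S.FglToFglxm.obj X) ≅ S.FglxmToFxm.obj (S.FglToFglxm.obj X))) :
    Nonempty (ThetaGauChain (ThetaLinkSetting.ofStripFrame S)) :=
  ThetaGauChain.nonempty_of_infinite_unitAut _ X h

/-- **IUTchII:Cor4.10(vi)** (kurims p.161) NEGATIVE over a strip frame: finitely many `F^⊩`-prime-strips with finite isomorphism
types, and finite isomorphism types of `F^{⊢×μ}`-prime-strips ⇒ NO chain of distinct theaters. [claim: Mochizuki2012, status: disputed] -/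
theorem isEmpty_thetaGauChain_of_finite [Finite S.Fgl] [∀ X Y : S.Fgl, Finite (X ≅ Y)]
    [∀ A B : S.Fxm, Finite (A ≅ B)] : IsEmpty (ThetaGauChain (ThetaLinkSetting.ofStripFrame S)) :=
  ThetaGauChain.isEmpty_of_finite _

/-- **IUTchII:Cor4.10(iv)** (kurims p.160) CONSUMER INSTANTIATED: over a frame with infinitely many `F^⊩`-prime-strips carrying the
[IUTchIII] Prop 2.1 / Thm 2.2 data, there IS a chain `{ⁿHT}_{n∈ℤ}` of distinct theaters, and along it "`(−)F^{⊢×μ}_△` is an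
invariant of both the `Θ^{×μ}`- and `Θ^{×μ}_{gau}`-links" (abc-iut-L6-d1's `unitMuCoric_chain`). [claim: Mochizuki2012, status: disputed] -/
theorem exists_thetaGauChain_unitMuCoric [Infinite S.Fgl] (T : ThetaMonoidData S) :
    ∃ P : ThetaGauChain (ThetaLinkSetting.ofStripFrame S),
      ∀ n : ℤ, (P.theater n).UnitMuCoric (P.theater (n + 1)) := by
  obtain ⟨P⟩ := nonempty_thetaGauChain_of_infinite_Fgl S
  exact ⟨P, fun n => unitMuCoric_chain T P n⟩

/-- **IUTchIII:Thm1.5(ii)** (kurims p.48) CONSUMER INSTANTIATED: over such a frame there IS a chain along which the functor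
`F^{⊩▶×μ} ↦ F^{⊢×μ}` carries BOTH links `ⁿF^{⊩▶×μ}_{env/gau} ⥲ ⁿ⁺¹F^{⊩▶×μ}_△` onto the full poly-isomorphism of `F^{⊢×μ}`-prime-strips
(abc-iut-L6-d1's `thm15ii_chain_map_full`). [claim: Mochizuki2012, status: disputed] -/
theorem exists_thetaGauChain_map_full [Infinite S.Fgl] (T : ThetaMonoidData S) :
    ∃ P : ThetaGauChain (ThetaLinkSetting.ofStripFrame S), ∀ n : ℤ,
      (PolyIso.full (S.FglToFglxm.obj (P.theater n).env) (S.FglToFglxm.obj (P.theater (n + 1)).delta)).map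
            S.FglxmToFxm = PolyIso.full _ _ ∧
        (PolyIso.full (S.FglToFglxm.obj (P.theater n).gau) (S.FglToFglxm.obj (P.theater (n + 1)).delta)).map
            S.FglxmToFxm = PolyIso.full _ _ := by
  obtain ⟨P⟩ := nonempty_thetaGauChain_of_infinite_Fgl S
  exact ⟨P, fun n => thm15ii_chain_map_full T P n⟩

end StripFrame

end Literature.IUT.LogThetaLattice

/-! ### 3. Kit level: how many `ℱ^⊩`-prime-strips, and how many isomorphisms, does a kit have? ([IUTchI] Def 5.2 (iv)) -/

namespace Literature.IUT.HodgeTheaters.PMBaseKit.FKit.FrStrip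

open CategoryTheory

universe u

variable {l : ℕ} {K : PMBaseKit.{u} l} {M : K.MultKit} {FK : K.FKit M}

/-- **IUTchI:Def5.2(iv)** (kurims p.134) An `ℱ^⊩`-prime-strip is determined by its collection of data `(‡𝒞^⊩, Prime(‡𝒞^⊩) ⥲ 𝕍,
‡𝔉^⊢, {‡ρ_v})`: the clause "(f) isomorphic to `ℱ^⊩_mod`" is a proposition. [claim: Mochizuki2012, status: disputed] -/
theorem obj_injective : Function.Injective (FrStrip.obj : FK.FrStrip → FK.RlfAmb) := by
  rintro ⟨a, ha⟩ ⟨b, hb⟩ (h : a = b)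
  subst h
  rfl

/-- **IUTchI:Def5.2(iv)** (kurims p.134) Two `ℱ^⊩`-prime-strips with the same collection of data are equal. [claim: Mochizuki2012, status: disputed] -/
theorem ext_obj {F₁ F₂ : FK.FrStrip} (h : F₁.obj = F₂.obj) : F₁ = F₂ :=
  obj_injective h

/-- **IUTchI:Def5.2(iv)** (kurims p.135) The MODEL `ℱ^⊩_mod` ([IUTchI] Ex 3.5 (ii)) is an `ℱ^⊩`-prime-strip of every kit. [claim: Mochizuki2012, status: disputed] -/
theorem nonempty_model : Nonempty FK.FrStrip := ⟨⟨FK.rlfModel, ⟨Iso.refl _⟩⟩⟩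

/-- **IUTchI:Def5.2(iv)** (kurims p.134) The `ℱ^⊩`-prime-strips of a kit are in bijection with the isomorphs of `ℱ^⊩_mod` in the
ambient category of collections of data. [claim: Mochizuki2012, status: disputed] -/
theorem nonempty_equiv_subtype :
    Nonempty (FK.FrStrip ≃ {X : FK.RlfAmb // Nonempty (X ≅ FK.rlfModel)}) :=
  ⟨{ toFun := fun F => ⟨F.obj, F.isModel⟩
     invFun := fun F => ⟨F.1, F.2⟩
     left_inv := fun _ => rfl
     right_inv := fun _ => rfl }⟩

/-- **IUTchI:Def5.2(iv)** (kurims p.134) Finitely many objects in the ambient category of collections of data ⇒ finitely many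
`ℱ^⊩`-prime-strips. [claim: Mochizuki2012, status: disputed] -/
theorem finite_of_finite [Finite FK.RlfAmb] : Finite FK.FrStrip :=
  Finite.of_injective _ obj_injective

/-- **IUTchI:Def5.2(iv)** (kurims p.134) CRITERION: infinitely many `ℱ^⊩`-prime-strips iff the isomorphs of `ℱ^⊩_mod` form an
infinite type (in print a proper class). [claim: Mochizuki2012, status: disputed] -/
theorem infinite_iff_subtype :
    Infinite FK.FrStrip ↔ Infinite {X : FK.RlfAmb // Nonempty (X ≅ FK.rlfModel)} :=
  (Classical.choice nonempty_equiv_subtype).infinite_iff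

/-- **IUTchI:Def5.2(iv)** (kurims p.135) "A morphism of `ℱ^⊩`-prime-strips is defined to be an isomorphism between collections of
data": the isomorphisms `F₁ ≅ F₂` of abc-iut-L6-t7's groupoid of `ℱ^⊩`-prime-strips ARE the ambient isomorphisms `F₁.obj ≅ F₂.obj`.
[claim: Mochizuki2012, status: disputed] -/
theorem nonempty_isoEquiv (F₁ F₂ : FK.FrStrip) : Nonempty ((F₁ ≅ F₂) ≃ (F₁.obj ≅ F₂.obj)) :=
  ⟨Groupoid.isoEquivHom F₁ F₂⟩

/-- **IUTchI:Def5.2(iv)** (kurims p.135) … so finitely many ambient isomorphisms ⇒ finitely many isomorphisms of `ℱ^⊩`-prime-strips.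
[claim: Mochizuki2012, status: disputed] -/
theorem finite_iso_of_finite (F₁ F₂ : FK.FrStrip) [Finite (F₁.obj ≅ F₂.obj)] : Finite (F₁ ≅ F₂) :=
  Finite.of_equiv _ (Classical.choice (nonempty_isoEquiv F₁ F₂)).symm

/-- **IUTchI:Def5.2(iv)** (kurims p.135) … and `Aut(‡𝔉^⊩)` is infinite iff `Aut` of its collection of data is. [claim: Mochizuki2012, status: disputed] -/
theorem infinite_iso_iff (F₁ F₂ : FK.FrStrip) : Infinite (F₁ ≅ F₂) ↔ Infinite (F₁.obj ≅ F₂.obj) :=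
  (Classical.choice (nonempty_isoEquiv F₁ F₂)).infinite_iff

end Literature.IUT.HodgeTheaters.PMBaseKit.FKit.FrStrip

/-! ### 4. At `StripFrame.ofKits` ([IUTchIII] Def 1.1 over the [IUTchI] kits) -/

namespace Literature.IUT.LogThetaLattice

open CategoryTheory
open Literature.IUT.HodgeArakelov Literature.IUT.HodgeTheaters Literature.IUT.HodgeTheaters.PMBaseKit

universe u

section OfKits

variable {l : ℕ} {K : PMBaseKit.{u} l} {M : K.MultKit} {FK : K.FKit M} (L : FK.MonoLaws)
  (hbij : FK.IsomFtoDBijective) (hsurj : FK.IsomFmtoDmSurjective) (hR : FK.RlfOfIsStrip) (X : TimesMuSide FK L)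

/-- **IUTchIII:Def1.1** (kurims p.23) The `F^⊩`-prime-strips of the assembled frame ARE (the small models of) abc-iut-L5-t4's
`ℱ^⊩`-prime-strips. [claim: Mochizuki2012, status: disputed] -/
theorem StripFrame.ofKits_Fgl : (StripFrame.ofKits L hbij hsurj hR X).Fgl = AsSmall.{max 1 u} FK.FrStrip := rfl

/-- **IUTchII:Cor4.10(i)** (kurims p.158) AT THE FRAME ASSEMBLED FROM THE KITS, for EVERY kit, the strip package of Cor 4.10 (i)–(iv)
EXISTS: the model `ℱ^⊩`-prime-strip `ℱ^⊩_mod` ([IUTchI] Ex 3.5 (ii)) in all five slots `†F^⊩_△, …, †F^⊩_gau`, identities as the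
identification / evaluation / unit-portion isomorphisms. GENUINE-frame inhabitant of abc-iut-L6-t2's interface `HodgeTheaterStrips`
relative to the kits (no toy choice). [claim: Mochizuki2012, status: disputed] -/
theorem StripFrame.nonempty_hodgeTheaterStrips_ofKits :
    Nonempty (HodgeTheaterStrips (ThetaLinkSetting.ofStripFrame (StripFrame.ofKits L hbij hsurj hR X))) :=
  HodgeTheaterStrips.nonempty_of_obj _ (AsSmall.up.obj ⟨FK.rlfModel, ⟨Iso.refl _⟩⟩)

/-- **IUTchII:Cor4.10(vi)** (kurims p.161) POSITIVE at `ofKits`: a kit with infinitely many `ℱ^⊩`-prime-strips gives the assembled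
frame a chain of DISTINCT `Θ^{±ell}NF`-Hodge theaters (through their strips). [claim: Mochizuki2012, status: disputed] -/
theorem StripFrame.nonempty_thetaGauChain_ofKits_of_infinite_frStrip (h : Infinite FK.FrStrip) :
    Nonempty (ThetaGauChain (ThetaLinkSetting.ofStripFrame (StripFrame.ofKits L hbij hsurj hR X))) :=
  haveI : Infinite (StripFrame.ofKits L hbij hsurj hR X).Fgl :=
    haveI := h
    Infinite.of_injective (fun F : FK.FrStrip => (AsSmall.up.obj F : AsSmall.{max 1 u} FK.FrStrip))
      fun _ _ hFG => congrArg ULift.down hFG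
  StripFrame.nonempty_thetaGauChain_of_infinite_Fgl _

/-- **IUTchII:Cor4.10(vi)** (kurims p.161) POSITIVE at `ofKits` from the ambient KIND: infinitely many isomorphs of `ℱ^⊩_mod` in the
ambient category of collections of data `RlfAmb` ⇒ a chain (in print the isomorphs form a proper class).
[claim: Mochizuki2012, status: disputed] -/
theorem StripFrame.nonempty_thetaGauChain_ofKits_of_infinite_isomorphs
    (h : Infinite {Y : FK.RlfAmb // Nonempty (Y ≅ FK.rlfModel)}) :
    Nonempty (ThetaGauChain (ThetaLinkSetting.ofStripFrame (StripFrame.ofKits L hbij hsurj hR X))) :=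
  StripFrame.nonempty_thetaGauChain_ofKits_of_infinite_frStrip L hbij hsurj hR X
    (FKit.FrStrip.infinite_iff_subtype.mpr h)

/-- **IUTchII:Cor4.10(vi)** (kurims p.161) POSITIVE at `ofKits` from the automorphisms of the MODEL: infinitely many automorphisms
of the collection of data `ℱ^⊩_mod = (𝒞^⊩_mod, Prime(𝒞^⊩_mod) ⥲ 𝕍, 𝔉^⊢_mod, {ρ_v})` ⇒ a chain (vary `†F^⊩_△ ⥲ †F^⊩_mod`). In print
`Aut(ℱ^⊩_mod)` contains the automorphisms of `𝔉^⊢_mod` compatible with the `ρ_v`, an infinite group — the intended reading.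
[claim: Mochizuki2012, status: disputed] -/
theorem StripFrame.nonempty_thetaGauChain_ofKits_of_infinite_aut (h : Infinite (FK.rlfModel ≅ FK.rlfModel)) :
    Nonempty (ThetaGauChain (ThetaLinkSetting.ofStripFrame (StripFrame.ofKits L hbij hsurj hR X))) := by
  refine StripFrame.nonempty_thetaGauChain_of_infinite_aut _
    (AsSmall.up.obj (⟨FK.rlfModel, ⟨Iso.refl _⟩⟩ : FK.FrStrip)) ?_
  haveI : Infinite ((⟨FK.rlfModel, ⟨Iso.refl _⟩⟩ : FK.FrStrip) ≅ ⟨FK.rlfModel, ⟨Iso.refl _⟩⟩) :=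
    (FKit.FrStrip.infinite_iso_iff _ _).mpr h
  exact (AsSmallTransport.isoEquiv _ _).symm.infinite_iff.mp ‹_›

/-- **IUTchII:Cor4.10(vi)** (kurims p.161) NEGATIVE at `ofKits`: over a kit whose ambient category of collections of data `RlfAmb`
has finitely many objects and finite isomorphism types, and whose `F^{⊢×μ}`-prime-strips (the [IUTchII] Def 4.9 input `X`) have
finite isomorphism types, the assembled frame carries NO chain of distinct `Θ^{±ell}NF`-Hodge theaters.
[claim: Mochizuki2012, status: disputed] -/
theorem StripFrame.isEmpty_thetaGauChain_ofKits_of_finite [Finite FK.RlfAmb]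
    [∀ A B : FK.RlfAmb, Finite (A ≅ B)] [∀ A B : X.Fxm, Finite (A ≅ B)] :
    IsEmpty (ThetaGauChain (ThetaLinkSetting.ofStripFrame (StripFrame.ofKits L hbij hsurj hR X))) := by
  haveI : Finite FK.FrStrip := FKit.FrStrip.finite_of_finite
  haveI : Finite (StripFrame.ofKits L hbij hsurj hR X).Fgl :=
    Finite.of_injective (fun F : AsSmall.{max 1 u} FK.FrStrip => ULift.down F) ULift.down_injective
  haveI : ∀ F G : (StripFrame.ofKits L hbij hsurj hR X).Fgl, Finite (F ≅ G) := fun F G =>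
    haveI : Finite (ULift.down F ≅ ULift.down G) := FKit.FrStrip.finite_iso_of_finite _ _
    Finite.of_equiv _ (AsSmallTransport.isoEquiv F G).symm
  haveI : ∀ A B : (StripFrame.ofKits L hbij hsurj hR X).Fxm, Finite (A ≅ B) := fun A B =>
    Finite.of_equiv _ (AsSmallTransport.isoEquiv A B).symm
  exact StripFrame.isEmpty_thetaGauChain_of_finite _

end OfKits

/-! ### 5. THE DECISION at the landed concrete kit: abc-iut-L5-t4's toy kit under abc-iut-L6-t3's toy frame -/

namespace KitsToy

variable (l : ℕ) [Fact l.Prime] (hl : l ≠ 2)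

/-- **IUTchI:Def5.2(iv)** (kurims p.134) In the toy kit (`RlfAmb = (𝕍 → {loc, glob})`, `ℱ^⊩_mod = (v ↦ loc)`, `Hom(glob, loc) = ∅`)
every `ℱ^⊩`-prime-strip IS the model: its collection of data is `v ↦ loc`. (toy-model plumbing, [IUTchI] Def 6.1 p.156)
[claim: Mochizuki2012, status: disputed] -/
theorem frStrip_obj_eq (F : (FKit.toy l hl).FrStrip) : F.obj = (FKit.toy l hl).rlfModel := by
  obtain ⟨φ⟩ := F.isModel
  funext v
  have ψ : F.obj v ≅ (Model.Obj.loc : Model.Obj l) := Pi.isoApp φ v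
  revert ψ
  change ∀ _ : ((F.obj v : Model.Obj l) ≅ (Model.Obj.loc : Model.Obj l)), (F.obj v : Model.Obj l) = Model.Obj.loc
  generalize (F.obj v : Model.Obj l) = x
  cases x with
  | loc => intro; rfl
  | glob => intro ψ; exact (ψ.hom : PEmpty).elim

/-- **IUTchI:Def5.2(iv)** (kurims p.134) The toy kit has exactly one `ℱ^⊩`-prime-strip up to equality. DISCLOSED TRUNCATION of the toy
(in print the isomorphs of `ℱ^⊩_mod` form a proper class). [claim: Mochizuki2012, status: disputed] -/
theorem subsingleton_frStrip : Subsingleton (FKit.toy l hl).FrStrip :=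
  ⟨fun F₁ F₂ => FKit.FrStrip.ext_obj ((frStrip_obj_eq l hl F₁).trans (frStrip_obj_eq l hl F₂).symm)⟩

/-- **IUTchI:Def5.2(iv)** (kurims p.134) … hence finitely many `ℱ^⊩`-prime-strips. [claim: Mochizuki2012, status: disputed] -/
theorem finite_frStrip : Finite (FKit.toy l hl).FrStrip :=
  haveI := subsingleton_frStrip l hl
  Finite.of_subsingleton

/-- **IUTchI:Def5.2(iv)** (kurims p.135) In the toy kit the isomorphisms between two `ℱ^⊩`-prime-strips are finite in number (an
isomorphism of the collections of data `v ↦ loc` is a family of elements of `Aut(loc) = ℤˣ` over the one place).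
[claim: Mochizuki2012, status: disputed] -/
theorem finite_frStrip_iso (F₁ F₂ : (FKit.toy l hl).FrStrip) : Finite (F₁ ≅ F₂) := by
  haveI : Finite (F₁.obj ⟶ F₂.obj) := by
    rw [frStrip_obj_eq l hl F₁, frStrip_obj_eq l hl F₂]
    change Finite (Unit → ℤˣ)
    infer_instance
  haveI : Finite (F₁.obj ≅ F₂.obj) := HodgeTheaterStrips.finite_iso_of_finite_hom _ _
  exact FKit.FrStrip.finite_iso_of_finite F₁ F₂

/-- **IUTchII:Def4.9(vii)** (kurims p.158) In the toy `TimesMuSide` the `F^{⊢×μ}`-prime-strips form the one-object groupoid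
`SingleObj Unit`: their isomorphism types are finite. [claim: Mochizuki2012, status: disputed] -/
theorem finite_fxm_iso (A B : (timesMuSide l hl).Fxm) : Finite (A ≅ B) :=
  haveI : Finite (A ⟶ B) := inferInstanceAs (Finite Unit)
  HodgeTheaterStrips.finite_iso_of_finite_hom A B

/-- **IUTchII:Cor4.10(i)** (kurims p.158) At the toy frame the strip package of Cor 4.10 (i)–(iv) EXISTS (instance of
`StripFrame.nonempty_hodgeTheaterStrips_ofKits`). [claim: Mochizuki2012, status: disputed] -/
theorem nonempty_hodgeTheaterStrips :
    Nonempty (HodgeTheaterStrips (ThetaLinkSetting.ofStripFrame (frame l hl))) :=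
  StripFrame.nonempty_hodgeTheaterStrips_ofKits _ _ _ _ _

/-- **IUTchII:Cor4.10(vi)** (kurims p.161) **THE DECISION (negative)**: abc-iut-L6-t3's toy frame `KitsToy.frame l hl = StripFrame.ofKits …`
over abc-iut-L5-t4's toy kits — the one `StripFrame.ofKits` instance in the tree — carries NO collection of DISTINCT
`Θ^{±ell}NF`-Hodge theaters indexed by `ℤ` (one `ℱ^⊩`-prime-strip, at most two automorphisms, trivial `F^{⊢×μ}`-automorphisms).
Consequently the consumers quantified over `P : ThetaGauChain (ThetaLinkSetting.ofStripFrame S)` (`unitMuCoric_chain`,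
`thm15ii_chain_map_full`, the Cor 4.11 chain lemmas) are, at `ofKits`, instantiated at NO landed kit; they are instantiated at
abc-iut-w5-d193's degenerate `ℤ`-labelled setting (`ThetaGauChain.nonempty_degenerate`) and under the § 2/§ 4 infinitude hypotheses.
A truncation of the toy, not a finding about the series. [claim: Mochizuki2012, status: disputed] -/
theorem isEmpty_thetaGauChain : IsEmpty (ThetaGauChain (ThetaLinkSetting.ofStripFrame (frame l hl))) :=
  haveI : Finite (FKit.toy l hl).FrStrip := finite_frStrip l hl
  haveI : Finite (frame l hl).Fgl :=
    Finite.of_injective (fun F : AsSmall.{1} (FKit.toy l hl).FrStrip => ULift.down F) ULift.down_injective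
  haveI : ∀ F G : (frame l hl).Fgl, Finite (F ≅ G) := fun F G =>
    haveI : Finite (ULift.down F ≅ ULift.down G) := finite_frStrip_iso l hl _ _
    Finite.of_equiv _ (AsSmallTransport.isoEquiv F G).symm
  haveI : ∀ A B : (frame l hl).Fxm, Finite (A ≅ B) := fun A B =>
    haveI : Finite (ULift.down A ≅ ULift.down B) := finite_fxm_iso l hl _ _
    Finite.of_equiv _ (AsSmallTransport.isoEquiv A B).symm
  StripFrame.isEmpty_thetaGauChain_of_finite _

/-- **IUTchII:Cor4.10(vi)** (kurims p.161) Equivalently: `¬ Nonempty (ThetaGauChain (ThetaLinkSetting.ofStripFrame (KitsToy.frame l hl)))`.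
[claim: Mochizuki2012, status: disputed] -/
theorem not_nonempty_thetaGauChain : ¬ Nonempty (ThetaGauChain (ThetaLinkSetting.ofStripFrame (frame l hl))) :=
  not_nonempty_iff.mpr (isEmpty_thetaGauChain l hl)

/-- **IUTchII:Cor4.10(vi)** (kurims p.161) … while the strip packages over the toy frame are FINITE in number (the exact condition of
abc-iut-w5-d193's `nonempty_iff_infinite`, failed). [claim: Mochizuki2012, status: disputed] -/
theorem not_infinite_hodgeTheaterStrips :
    ¬ Infinite (HodgeTheaterStrips (ThetaLinkSetting.ofStripFrame (frame l hl))) :=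
  fun h => not_nonempty_thetaGauChain l hl ((ThetaGauChain.nonempty_iff_infinite _).mpr h)

end KitsToy

end Literature.IUT.LogThetaLattice
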